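import Summits.AtomisticToContinuum.HydrodynamicLimit.Theorems.CollisionIsometryCLTMacroClosureEngineEntropyLedgerA
import Summits.AtomisticToContinuum.HydrodynamicLimit.Theorems.CollisionIsometryCLTMacroClosureEngineObsCommutator
import Summits.AtomisticToContinuum.HydrodynamicLimit.Theorems.CollisionIsometryCLTMacroClosureEngineIsentropic
import Summits.AtomisticToContinuum.HydrodynamicLimit.Theorems.CollisionIsometryCLTMacroClosureStubClausiusLimits
import Summits.AtomisticToContinuum.HydrodynamicLimit.Theses.StiffCollisionalRelaxation
import HarnessLib

/-!
# Sub-goal `engine_entropyLedger` of the lead's stub `stub_engine` (line `IdeatorTwoGen1Sketch`, crux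
# `MacroClosure`, stmt-AtomisticToContinuum-14870): the entropy ledger (hypothesis (a) of `engine_core`)

For a classical hs-Euler solution `(ρ, u, θ)` on `[0, T)` in the dilute chamber of `ThermoChamber η₃`, local
Gibbs initial laws `P_N = localGibbsLaw σ a₀ u₀ θ₀ N (Φ N)` (`σ ≤ 1/2`), an admissible kernel family
`φ_N` (mesoscale exponent `0 < γ ≤ 1/15`), a time `0 < t < T`, and measurable good events `G_N ⊆ good` on which
all blocks stay in the band `c₁ ≤ ρ̄ ≤ σ⁻³` for `s ∈ [0, t]`, with `P_N(G_Nᶜ) → 0` and CLAUSIUS IN MEAN on `G_N`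
(`E[𝟙_G ∫ₓ η_σ(Ū_N(s))] ≤ ∫ₓ η_σ(U_cl(0)) + δ'` eventually, uniformly in `s ∈ [0,t]`), the ENTROPY LEDGER holds:
for every `δ > 0`, eventually in `N`, for all `s ∈ [0, t]`,
`H_N(s) := E[𝟙_G ∫ₓ h_σ(Ū_N(s,x) | U_cl(s,x)) dx]` and `ℓ_N(s) := E[𝟙_G (Obs(s, Φ_s z) − ∫ₓ Λ_cl(s,x)·U_cl(s,x) dx)]`
have integrable integrands and `H_N(s) + ℓ_N(s) ≤ δ`.

Proof (Bregman telescope). At fixed `N`, `s` (`EngineEntropyLedger.ledger_fixed`, part A): almost surely on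
`G_N` every block carries two particles with distinct velocities (kernel bound `C(N+1)^{3γ} < (N+1)c₁`
eventually, `3γ < 1`; `Clausius.ae_pairwise_vel_ne`), so `x ↦ η_σ(Ū)` is continuous (Ruelle convexity
`HsFreeEnergyConvex` makes `f_ex` continuous on the band packings, `Clausius.continuousOn_hsExcessFreeEnergy`) and
`∫ₓ h_σ(Ū|U_s) = ∫ₓ η_σ(Ū) − ∫ₓ η_σ(U_s) − ∫ₓ Λ_s·Ū + ∫ₓ Λ_s·U_s`; hence
`H_N + ℓ_N ≤ E[𝟙_G ∫η_σ(Ū)] − P(G_N) ∫ₓ η_σ(U_s) + C r_N (1 + 2(M₀+1))` by the observable commutator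
(`engine_obsCommutator`, radius `r_N = (N+1)^{-γ}`), conservation of the kinetic energy on good orbits and its
uniform second moment `M₀` (`stub_clausius_moment`). ISENTROPY of the classical solution (`engine_isentropic`:
`∫ₓ η_σ(U_s) = ∫ₓ η_σ(U_0)`), Clausius in mean at `δ/3`, `P(G_Nᶜ)|∫η_σ(U_0)| ≤ δ/3` and `C r_N(3 + 2M₀) ≤ δ/3`
eventually close the ledger.
-/

noncomputable section

open MeasureTheory Filter Set Topology InformationTheory
open scoped ENNReal ContDiff

namespace Summit.AtomisticToContinuum.HydrodynamicLimit.Theorems.MacroClosureLine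

open Literature.MathematicalPhysics.KineticTheory Literature.Analysis.FluidPDE
open Literature.Analysis.FunctionSpaces
open Summit.AtomisticToContinuum.HydrodynamicLimit.Theses

namespace Barycentric

/-- **`engine_entropyLedger` (registered sub-goal of `stub_engine`): the entropy ledger.** Under Clausius in
mean on the good band events, for every `δ > 0`, eventually in `N` and uniformly in `s ∈ [0, t]`, the conditional
relative entropy `H_N(s) = E[𝟙_G ∫ₓ h_σ(Ū_N(s)|U_cl(s))]` and the centred linear statistic
`ℓ_N(s) = E[𝟙_G (Obs(s) − ∫ₓ Λ_cl(s)·U_cl(s))]` have integrable integrands and `H_N(s) + ℓ_N(s) ≤ δ`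
(Bregman telescope + isentropy of the classical solution + observable commutator). -/
theorem engine_entropyLedger : ∀ (σ : ℝ), 0 < σ → σ ≤ 1 / 2 → StiffCollisionalRelaxation.HsFreeEnergyConvex → ∀ (a₀ θ₀ : T3 → ℝ) (u₀ : T3 → V3), Continuous a₀ → Continuous θ₀ → Continuous u₀ → (∀ x, 0 < a₀ x) → (∀ x, 0 < θ₀ x) → ∀ (T : ℝ) (ρ θ : ℝ → T3 → ℝ) (u : ℝ → T3 → V3), IsHardSphereEulerSolution σ T ρ u θ → ∀ η₃ : ℝ, ThermoChamber η₃ → (∀ s ∈ Ico 0 T, ∀ x, ρ s x * σ ^ 3 < η₃) → ∀ (Φ : (N : ℕ) → Flow σ N) (γ C : ℝ) (φ : ℕ → T3 → ℝ), 0 < γ → γ ≤ 1 / 15 → AdmissibleKernel γ C φ → ∀ (t c₁ : ℝ), 0 < t → t < T → 0 < c₁ → c₁ * σ ^ 3 ≤ 1 → ∀ G : (N : ℕ) → Set (Config (N + 1) (Fin 3) T3), (∀ N, MeasurableSet (G N)) → (∀ N, G N ⊆ (Φ N).good) → (∀ N, ∀ z ∈ G N, ∀ s ∈ Icc 0 t,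 ∀ x, c₁ ≤ bρ (φ N) ((Φ N).flow s z) x ∧ bρ (φ N) ((Φ N).flow s z) x * σ ^ 3 ≤ 1) → Tendsto (fun N : ℕ => localGibbsLaw σ a₀ u₀ θ₀ N (Φ N) (G N)ᶜ) atTop (𝓝 0) → (∀ δ : ℝ, 0 < δ → ∀ᶠ N : ℕ in atTop, ∀ s ∈ Icc 0 t, Integrable (fun z => (G N).indicator (fun z => ∫ x, hsEntropy σ (bU (φ N) ((Φ N).flow s z) x)) z) (localGibbsLaw σ a₀ u₀ θ₀ N (Φ N)) ∧ ∫ z, (G N).indicator (fun z => ∫ x, hsEntropy σ (bU (φ N) ((Φ N).flow s z) x)) z ∂(localGibbsLaw σ a₀ u₀ θ₀ N (Φ N)) ≤ (∫ x, hsEntropy σ (stateOf (ρ 0 x) (u 0 x) (θ 0 x))) + δ) → ∀ δ : ℝ, 0 < δ → ∀ᶠ N : ℕ in atTop, ∀ s ∈ Icc 0 t, Integrable (fun z => (G N).indicator (fun z => ∫ x, relEnt σ (bU (φ N) ((Φ N).flow s z) x) (Ucl ρ θ u s x)) z) (localGibbsLaw σ a₀ u₀ θ₀ N (Φ N)) ∧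 Integrable (fun z => (G N).indicator (fun z => obs σ ρ θ u s ((Φ N).flow s z) - ∫ x, Lcl σ ρ θ u s x (Ucl ρ θ u s x)) z) (localGibbsLaw σ a₀ u₀ θ₀ N (Φ N)) ∧ (∫ z, (G N).indicator (fun z => ∫ x, relEnt σ (bU (φ N) ((Φ N).flow s z) x) (Ucl ρ θ u s x)) z ∂(localGibbsLaw σ a₀ u₀ θ₀ N (Φ N))) + ∫ z, (G N).indicator (fun z => obs σ ρ θ u s ((Φ N).flow s z) - ∫ x, Lcl σ ρ θ u s x (Ucl ρ θ u s x)) z ∂(localGibbsLaw σ a₀ u₀ θ₀ N (Φ N)) ≤ δ := by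
  intro σ hσ hσ2 hH a₀ θ₀ u₀ ha hθ hu ha0 hθ0 T ρ θ u hE η₃ hTC hpack Φ γ C φ hγ hγ' hker t c₁ ht htT hc₁
    _hc₁σ G hGm hGgood hGband hGc hCl δ hδ
  -- the kernel family
  obtain ⟨hφs, hφ0, hφ1, hφsupp, hφb, -⟩ := hker
  -- clause 3 of `ThermoChamber`: `Λ = Dη_σ(U_cl)` is jointly smooth with explicit form
  obtain ⟨hΛ0, hΛeq, -, -⟩ := (hTC σ hσ).2.2 T ρ θ u hE hpack
  have hΛ : Torus.IsSmoothSpaceTimeOn (Ico 0 T) (Lcl σ ρ θ u) := hΛ0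
  have hinner : ∀ a b : V3, inner ℝ a b = ∑ j, a j * b j := fun a b => by
    rw [PiLp.inner_apply]
    exact Finset.sum_congr rfl fun j _ => by rw [RCLike.inner_apply, conj_trivial, mul_comm]
  have hL : ∀ s ∈ Ico 0 T, ∀ (x : T3) (V : State), Lcl σ ρ θ u s x V =
      lam0 σ ρ θ u s x * V.1 + (∑ j, lamM θ u s x j * V.2.1 j) + lamE θ s x * V.2.2 := by
    intro s hs x V
    have h := hΛeq s hs x V
    rw [← hinner]
    simp only [Lcl, Ucl, lam0, lamM, lamE]
    rw [h]
    ring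
  -- joint smoothness of the entropy variables, of `U_cl` and of `η_σ ∘ U_cl`
  have h0 : Torus.IsSmoothSpaceTimeOn (Ico 0 T) (lam0 σ ρ θ u) := by
    refine (hΛ0.clm_comp
      (ContinuousLinearMap.apply ℝ ℝ (((1 : ℝ), ((0 : V3), (0 : ℝ))) : State))).congr ?_
    rintro ⟨s, y⟩ hp
    have hs : s ∈ Ico 0 T := (mem_prod.1 hp).1
    simp only [Torus.stLift_apply, ContinuousLinearMap.apply_apply]
    rw [hΛeq s hs]
    simp [lam0]
  have hθinv : Torus.IsSmoothSpaceTimeOn (Ico 0 T) (fun s x => (θ s x)⁻¹) :=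
    ContDiffOn.inv hE.smooth_temperature fun p hp =>
      (hE.temperature_pos p.1 (mem_prod.1 hp).1 (Torus.proj p.2)).ne'
  have hMst : Torus.IsSmoothSpaceTimeOn (Ico 0 T) (lamM θ u) := hθinv.smul hE.smooth_velocity
  have hEst : Torus.IsSmoothSpaceTimeOn (Ico 0 T) (lamE θ) := hθinv.neg
  have hU : Torus.IsSmoothSpaceTimeOn (Ico 0 T) (Ucl ρ θ u) := isSmoothSpaceTimeOn_stateOf hE
  have hηst := EngineIsentropic.isSmoothSpaceTimeOn_entropy hσ hTC hE hpack
  -- uniform bounds of the entropy variables on the compact `[0, t] × T³`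
  have hKS : Icc (0 : ℝ) t ⊆ Ico 0 T := Icc_subset_Ico_right htT
  obtain ⟨A0, hA0⟩ := h0.exists_norm_le_of_isCompact isCompact_Icc hKS
  obtain ⟨AM, hAM⟩ := hMst.exists_norm_le_of_isCompact isCompact_Icc hKS
  obtain ⟨AE, hAE⟩ := hEst.exists_norm_le_of_isCompact isCompact_Icc hKS
  -- the observable commutator, the uniform second moment, `f_ex` on the band packings
  obtain ⟨Cc, hCc0, hCc⟩ := engine_obsCommutator σ hσ T ρ θ u hE η₃ hTC hpack t ht htT
  obtain ⟨M₀, hM₀⟩ := stub_clausius_moment a₀ θ₀ u₀ ha hθ hu ha0 hθ0 σ hσ2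
  have hM₀0 : 0 ≤ M₀ := (integral_nonneg fun z => sq_nonneg _).trans (hM₀ 0 (Φ 0)).2
  have hfex : ContinuousOn hsExcessFreeEnergy (Icc (c₁ * σ ^ 3) 1) :=
    (Clausius.continuousOn_hsExcessFreeEnergy hH).mono (Icc_subset_Ioo (by positivity) (by norm_num))
  haveI : ∀ N, IsProbabilityMeasure (localGibbsLaw σ a₀ u₀ θ₀ N (Φ N)) := fun N =>
    isProbabilityMeasure_localGibbsLaw ha hθ hu ha0 hθ0 hσ2 N (Φ N)
  -- the four eventualities: Clausius at `δ/3`, two particles per block, `P(Gᶜ)` small, radius small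
  have e1 := hCl (δ / 3) (by positivity)
  have e2 := Clausius.eventually_kernel_lt (C := C) (by linarith : 3 * γ < 1) hc₁
  have e3 : ∀ᶠ N : ℕ in atTop, (localGibbsLaw σ a₀ u₀ θ₀ N (Φ N)).real (G N)ᶜ *
      |∫ x, hsEntropy σ (stateOf (ρ 0 x) (u 0 x) (θ 0 x))| ≤ δ / 3 := by
    have h := EngineEntropyLedger.eventually_real_le hGc
      (ε := δ / (3 * (|∫ x, hsEntropy σ (stateOf (ρ 0 x) (u 0 x) (θ 0 x))| + 1))) (by positivity)
    filter_upwards [h] with N hN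
    have hS := abs_nonneg (∫ x, hsEntropy σ (stateOf (ρ 0 x) (u 0 x) (θ 0 x)))
    calc (localGibbsLaw σ a₀ u₀ θ₀ N (Φ N)).real (G N)ᶜ * |∫ x, hsEntropy σ (stateOf (ρ 0 x) (u 0 x) (θ 0 x))|
        ≤ δ / (3 * (|∫ x, hsEntropy σ (stateOf (ρ 0 x) (u 0 x) (θ 0 x))| + 1)) *
            |∫ x, hsEntropy σ (stateOf (ρ 0 x) (u 0 x) (θ 0 x))| := mul_le_mul_of_nonneg_right hN hS
      _ ≤ δ / 3 := by
          rw [div_mul_eq_mul_div, div_le_div_iff₀ (by positivity) (by positivity)]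
          nlinarith
  have e4 : ∀ᶠ N : ℕ in atTop, Cc * ((N : ℝ) + 1) ^ (-γ) * (1 + 2 * (M₀ + 1)) ≤ δ / 3 := by
    have h : Tendsto (fun N : ℕ => Cc * ((N : ℝ) + 1) ^ (-γ) * (1 + 2 * (M₀ + 1))) atTop
        (𝓝 (Cc * 0 * (1 + 2 * (M₀ + 1)))) :=
      (((tendsto_rpow_neg_atTop hγ).comp
        (tendsto_atTop_add_const_right _ _ tendsto_natCast_atTop_atTop)).const_mul Cc).mul_const _
    rw [mul_zero, zero_mul] at h
    exact h.eventually_le_const (by positivity)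
  filter_upwards [e1, e2, e3, e4] with N hN1 hN2 hN3 hN4
  intro s hs
  have hsT : s ∈ Ico 0 T := hKS hs
  obtain ⟨hIint, hIle⟩ := hN1 s hs
  -- time-`s` data
  have hΛc : Continuous (Lcl σ ρ θ u s) := (hΛ.isSmooth_slice hsT).continuous
  have hUc : Continuous (Ucl ρ θ u s) := (hU.isSmooth_slice hsT).continuous
  have hηU : Continuous fun x => hsEntropy σ (Ucl ρ θ u s x) := (hηst.isSmooth_slice hsT).continuous
  have h0c : Continuous (lam0 σ ρ θ u s) := (h0.isSmooth_slice hsT).continuous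
  have hMc : Continuous (lamM θ u s) := (hMst.isSmooth_slice hsT).continuous
  have hEc : Continuous (lamE θ s) := (hEst.isSmooth_slice hsT).continuous
  have hA0' : ∀ x, |lam0 σ ρ θ u s x| ≤ A0 := fun x => by
    simpa only [Real.norm_eq_abs] using hA0 s hs x
  have hAM' : ∀ x j, |lamM θ u s x j| ≤ AM := fun x j => by
    have h1 : |lamM θ u s x j| ≤ ‖lamM θ u s x‖ := by simpa using PiLp.norm_apply_le (lamM θ u s x) j
    exact h1.trans (hAM s hs x)
  have hAE' : ∀ x, |lamE θ s x| ≤ AE := fun x => by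
    simpa only [Real.norm_eq_abs] using hAE s hs x
  -- the commutator at `(N, s)` with the radius `r_N = (N+1)^{-γ}`
  have hK : 0 ≤ Cc * ((N : ℝ) + 1) ^ (-γ) := mul_nonneg hCc0 (Real.rpow_nonneg (by positivity) _)
  have hcomm : ∀ w : Config (N + 1) (Fin 3) T3,
      |(∫ x, Lcl σ ρ θ u s x (bU (φ N) w x)) - obs σ ρ θ u s w| ≤
        Cc * ((N : ℝ) + 1) ^ (-γ) * ∫ y, (1 + ‖y.2‖ ^ 2) ∂(empiricalMeasure w) := fun w =>
    hCc N (φ N) _ (hφs N) (hφ0 N) (hφ1 N) (hφsupp N) w s hs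
  -- the ledger at fixed `(N, s)`
  obtain ⟨hR, hB, hle⟩ := EngineEntropyLedger.ledger_fixed hσ hσ2 ha hθ hu ha0 hθ0 (hL s hsT) hΛc hUc hηU
    h0c hMc hEc hA0' hAM' hAE' (Φ N) (hφs N).continuous (hφ0 N) (hφ1 N) (hφb N) hN2 hc₁ hfex (hGm N)
    (hGgood N) (fun z hz x => hGband N z hz s hs x) hK hcomm (hM₀ N (Φ N)).1 (hM₀ N (Φ N)).2 hIint
  refine ⟨hR, hB, hle.trans ?_⟩
  -- bookkeeping: isentropy, Clausius at `δ/3`, `P(G) = 1 − P(Gᶜ)`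
  have hiso : ∫ x, hsEntropy σ (Ucl ρ θ u s x) = ∫ x, hsEntropy σ (stateOf (ρ 0 x) (u 0 x) (θ 0 x)) :=
    engine_isentropic σ hσ T ρ θ u hE η₃ hTC hpack s hs.1 hsT.2
  have hPG : (localGibbsLaw σ a₀ u₀ θ₀ N (Φ N)).real (G N) =
      1 - (localGibbsLaw σ a₀ u₀ θ₀ N (Φ N)).real (G N)ᶜ := by
    rw [probReal_compl_eq_one_sub (hGm N)]
    ring
  have hp : (localGibbsLaw σ a₀ u₀ θ₀ N (Φ N)).real (G N)ᶜ *
      ∫ x, hsEntropy σ (stateOf (ρ 0 x) (u 0 x) (θ 0 x)) ≤ δ / 3 :=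
    (le_abs_self _).trans (by rw [abs_mul, abs_of_nonneg measureReal_nonneg]; exact hN3)
  rw [hiso, hPG]
  nlinarith [hIle, hp, hN4]

end Barycentric

end Summit.AtomisticToContinuum.HydrodynamicLimit.Theorems.MacroClosureLine

end
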